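import Literature.NumberTheory.LFunctions.RodgersTaoAsymptotics
import Literature.NumberTheory.LFunctions.DobnerLemma4Tools
import HarnessLib

/-!
# Rodgers–Tao 2020, proof of Lemma 2.1 (FMP pp. 17–18): the real part of the phase in regime (ii)
— node R2 of the R19 reduction (`rodgersTao_H_eq_half_Q_one`)

RH-FREE literature PROOFS (no definitions, no named facts). Trunk T-ANT
(`Literature/NumberTheory/LFunctions`); node **R2** of rt-lead ruling (39)(c) (rt/STATUS
2026-08-26): the «pure-real exponent lemma» of regime (ii) in the proof of Lemma 2.1 of
B. Rodgers, T. Tao, *The de Bruijn–Newman constant is non-negative*, Forum Math. Pi 8 (2020) e6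
= arXiv:1801.05914 (v5 TeX l.436–456 = FMP pp. 17–18), stated over the §2 statement module
`RodgersTaoAsymptotics.lean` only (`rodgersTaoSaddleEq`, `rodgersTaoStrip`, the Lemma 2.3 (ii)
expansions), for t6's `RodgersTaoTailSumProofs.lean` (R1/R3) and t7's assembly (R4) to import.

> (FMP pp. 17–18) «if we apply Lemma 2.3 (ii) with `ζ = 9 + y + ix` and `b = πn²` … the quantity
> `w₀` obeys `w₀ = ¼ log(x/4πn²) + O^ℝ(1/x) + i(π/8 − (9+y)/(4x) − t log(x/4πn²)/(8x)
> + O^ℝ_C(log²₊x/x^{3/2}))` … we can calculate the quantity `Re(tw₀² − ζ/4 − tw₀/2 + ζw₀)` to be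
> `(t/16) log²(x/4πn²) − tπ²/64 − (9+y)/4 − (t/8) log(x/4πn²) + ((9+y)/4) log(x/4πn²) − πx/8
> + (9+y)/4 + (t/8) log(x/4πn²) + O_C(x^{−1/2})`» — here as a one-sided bound with an explicit
> `O(1)` slack, which is all the tail sum needs (the `n ≥ 2` terms are only bounded above).

## Main results

* `rodgersTao_re_mul_exp_of_saddleEq` — from (23): `Re(b e^{4w₀}) = (Re ζ + 2t Re w₀)/4`;
* `rodgersTao_re_phase_of_saddleEq` — `Re(tw₀² − be^{4w₀} + ζw₀) = t(α² − β²) − (Re ζ + 2tα)/4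
  + Re ζ · α − Im ζ · β` (`w₀ = α + iβ`);
* `rodgersTao_re_phase_le_core` — the elementary real inequality behind the displayed computation;
* `rodgersTao_abs_mul_abs_log_le` — in regime (ii) `|t|·|log(x/4b)| ≤ T₀(log x + log 4) + 100√x`
  («this is where (33)'s `1/|t|` matters»);
* `rodgersTao_eventually_regimeTwo_thresholds` — the `x ≥ X(T₀, C)` thresholds;
* the R2 theorem in t6's frozen shape (appended below once posted on rt/STATUS).

LABEL: RH-FREE CONTENT (0 facts). bears_on: N-C/N-P (COLUMN 3 DBN).
WHAT THIS IS NOT: an exponent computation inside Rodgers–Tao's RH-free asymptotic for `H_t`,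
`t < 0`; nothing here bears on the truth of RH.
-/

noncomputable section

open Complex Filter Set Topology Real

namespace Literature.NumberTheory.LFunctions

/-- From the saddle-point equation `4b e^{4w₀} = ζ + 2t w₀`: `Re(b e^{4w₀}) = (Re ζ + 2t Re w₀)/4`.
[cite: RodgersTaoFMP2020, §2 eq. (23) (FMP p. 12) and p. 17 («4be^{4w₀} = ix + O_C(x^{1/2})»)] -/
theorem rodgersTao_re_mul_exp_of_saddleEq {t b : ℝ} {ζ w₀ : ℂ} (h : rodgersTaoSaddleEq t b ζ w₀) :
    ((b : ℂ) * Complex.exp (4 * w₀)).re = (ζ.re + 2 * t * w₀.re) / 4 := by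
  unfold rodgersTaoSaddleEq at h
  have h' : (b : ℂ) * Complex.exp (4 * w₀) = (ζ + 2 * t * w₀) / 4 := by
    rw [← h]; ring
  rw [h']
  simp [Complex.add_re, Complex.mul_re]

/-- The real part of the exponent `t w₀² − b e^{4w₀} + ζ w₀` at a solution of the saddle-point
equation: `t(α² − β²) − (Re ζ + 2tα)/4 + Re ζ · α − Im ζ · β`.
[cite: RodgersTaoFMP2020, §2 proof of Lemma 2.1, display «Re(tw₀² − ζ/4 − tw₀/2 + ζw₀)» p. 17] -/
theorem rodgersTao_re_phase_of_saddleEq {t b : ℝ} {ζ w₀ : ℂ} (h : rodgersTaoSaddleEq t b ζ w₀) :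
    (t * w₀ ^ 2 - (b : ℂ) * Complex.exp (4 * w₀) + ζ * w₀).re =
      t * (w₀.re ^ 2 - w₀.im ^ 2) - (ζ.re + 2 * t * w₀.re) / 4 + ζ.re * w₀.re - ζ.im * w₀.im := by
  rw [Complex.add_re, Complex.sub_re, rodgersTao_re_mul_exp_of_saddleEq h]
  simp only [Complex.mul_re, Complex.mul_im, sq, Complex.ofReal_re, Complex.ofReal_im]
  ring

/-- In regime (ii) (`b ≤ x e^{100√x/|t|}`, `b ≥ 1`, `t ∈ [−T₀, 0)`): `|t| · |log(x/(4b))| ≤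
T₀ (log x + log 4) + 100 √x` for `x ≥ 1`.
[cite: RodgersTaoFMP2020, §2 eq. (33) (FMP p. 17)] -/
theorem rodgersTao_abs_mul_abs_log_le {T₀ t b x : ℝ} (ht : t ∈ Ico (-T₀) 0) (hb : 1 ≤ b)
    (hx : 1 ≤ x)
    (hreg : b ≤ x * Real.exp (100 * Real.sqrt x / |t|)) :
    |t| * |Real.log (x / (4 * b))| ≤ T₀ * (Real.log x + Real.log 4) + 100 * Real.sqrt x := by
  obtain ⟨ht1, ht2⟩ := ht
  have ht' : 0 < |t| := abs_pos.2 ht2.ne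
  have htT : |t| ≤ T₀ := by rw [abs_of_neg ht2]; linarith
  have hT0 : 0 ≤ T₀ := ht'.le.trans htT
  have hx0 : 0 < x := by linarith
  have hb0 : 0 < b := by linarith
  have hlogx : 0 ≤ Real.log x := Real.log_nonneg hx
  have hlog4 : 0 ≤ Real.log 4 := Real.log_nonneg (by norm_num)
  have e : Real.log (x / (4 * b)) = Real.log x - Real.log 4 - Real.log b := by
    rw [Real.log_div hx0.ne' (by positivity), Real.log_mul (by norm_num) hb0.ne']; ring
  have hlogb0 : 0 ≤ Real.log b := Real.log_nonneg hb
  have hlogb : Real.log b ≤ Real.log x + 100 * Real.sqrt x / |t| := by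
    have := Real.log_le_log hb0 hreg
    rwa [Real.log_mul hx0.ne' (Real.exp_pos _).ne', Real.log_exp] at this
  rw [e]
  rcases le_or_gt 0 (Real.log x - Real.log 4 - Real.log b) with h | h
  · rw [abs_of_nonneg h]
    calc |t| * (Real.log x - Real.log 4 - Real.log b) ≤ |t| * (Real.log x + Real.log 4) := by
          refine mul_le_mul_of_nonneg_left ?_ ht'.le; linarith
      _ ≤ T₀ * (Real.log x + Real.log 4) := mul_le_mul_of_nonneg_right htT (by positivity)
      _ ≤ _ := le_add_of_nonneg_right (by positivity)
  · rw [abs_of_neg h]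
    have : |t| * (Real.log b) ≤ |t| * Real.log x + 100 * Real.sqrt x := by
      calc |t| * Real.log b ≤ |t| * (Real.log x + 100 * Real.sqrt x / |t|) :=
            mul_le_mul_of_nonneg_left hlogb ht'.le
        _ = |t| * Real.log x + 100 * Real.sqrt x := by field_simp
    calc |t| * -(Real.log x - Real.log 4 - Real.log b)
        = |t| * Real.log b + |t| * Real.log 4 - |t| * Real.log x := by ring
      _ ≤ (|t| * Real.log x + 100 * Real.sqrt x) + T₀ * Real.log 4 - 0 := by
          gcongr
          · exact mul_nonneg ht'.le hlogx
      _ ≤ T₀ * (Real.log x + Real.log 4) + 100 * Real.sqrt x := by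
          nlinarith [mul_le_mul_of_nonneg_right htT hlogx]

/-- Thresholds: for all large `x`, `T₀ (log x + log 4) + 100 √x ≤ x`, `log₊² x ≤ √x`,
`c · log₊ x ≤ x`, `T₀ ≤ x`, `1 ≤ x`. [folklore] -/
private theorem rodgersTao_eventually_regimeTwo_thresholds (T₀ c : ℝ) : ∀ᶠ x : ℝ in atTop,
    T₀ * (Real.log x + Real.log 4) + 100 * Real.sqrt x ≤ x ∧ logPlus x ^ 2 ≤ Real.sqrt x ∧
      c * logPlus x ≤ x ∧ T₀ ≤ x ∧ 1 ≤ x := by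
  -- `logPlus x = log (2 + x) ≤ 2 log x` for `x ≥ 2`
  have hlp : ∀ᶠ x : ℝ in atTop, logPlus x ≤ 2 * Real.log x := by
    filter_upwards [eventually_ge_atTop (2 : ℝ)] with x hx
    rw [logPlus_eq, abs_of_nonneg (by linarith)]
    have : 2 + x ≤ x ^ 2 := by nlinarith
    calc Real.log (2 + x) ≤ Real.log (x ^ 2) := Real.log_le_log (by linarith) this
      _ = 2 * Real.log x := by rw [Real.log_pow]; norm_num
  have h1 : ∀ᶠ x : ℝ in atTop, |T₀| * Real.log x ≤ x ^ (1 / 2 : ℝ) :=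
    eventually_const_mul_log_le_rpow |T₀| (by norm_num)
  have h2 : ∀ᶠ x : ℝ in atTop, (|T₀| * Real.log 4 + 100 + 1) * x ^ (1 / 2 : ℝ) ≤ x ^ (1 : ℝ) :=
    eventually_const_mul_rpow_le_rpow _ (by norm_num)
  have h3 : ∀ᶠ x : ℝ in atTop, (4 : ℝ) * x ^ (0 : ℝ) * Real.log x ≤ x ^ (1 / 4 : ℝ) :=
    eventually_const_mul_rpow_mul_log_le_rpow 4 (by norm_num)
  have h4 : ∀ᶠ x : ℝ in atTop, (2 * |c|) * Real.log x ≤ x ^ (1 : ℝ) :=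
    eventually_const_mul_log_le_rpow _ (by norm_num)
  filter_upwards [hlp, h1, h2, h3, h4, eventually_ge_atTop (max T₀ 1), eventually_ge_atTop (1 : ℝ)]
    with x hlpx h1x h2x h3x h4x hT hx1
  have hx0 : 0 < x := by linarith
  have hsqrt : Real.sqrt x = x ^ (1 / 2 : ℝ) := Real.sqrt_eq_rpow x
  have hx1' : (1 : ℝ) ≤ x ^ (1 / 2 : ℝ) := Real.one_le_rpow hx1 (by norm_num)
  have hlog0 : 0 ≤ Real.log x := Real.log_nonneg hx1
  refine ⟨?_, ?_, ?_, le_trans (le_max_left _ _) hT, hx1⟩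
  · rw [hsqrt]
    rw [Real.rpow_one] at h2x
    have hlog4 : 0 ≤ Real.log 4 := Real.log_nonneg (by norm_num)
    have : T₀ * (Real.log x + Real.log 4) ≤ |T₀| * Real.log x + |T₀| * Real.log 4 := by
      have := le_abs_self T₀
      nlinarith
    have hA : 0 ≤ |T₀| * Real.log 4 := mul_nonneg (abs_nonneg _) hlog4
    have hB : |T₀| * Real.log 4 ≤ |T₀| * Real.log 4 * x ^ (1 / 2 : ℝ) :=
      le_mul_of_one_le_right hA hx1'
    have h2x' :
        |T₀| * Real.log 4 * x ^ (1 / 2 : ℝ) + 100 * x ^ (1 / 2 : ℝ) + x ^ (1 / 2 : ℝ) ≤ x := by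
      linarith
    linarith
  · rw [hsqrt]
    rw [Real.rpow_zero, mul_one] at h3x
    have hl : logPlus x ≤ 2 * Real.log x := hlpx
    have hl0 : 0 ≤ logPlus x := logPlus_nonneg x
    have e : (x ^ (1 / 4 : ℝ)) ^ 2 = x ^ (1 / 2 : ℝ) := by
      rw [← Real.rpow_natCast, ← Real.rpow_mul hx0.le]; norm_num
    calc logPlus x ^ 2 ≤ (2 * Real.log x) ^ 2 := pow_le_pow_left₀ hl0 hl 2
      _ = (4 * Real.log x) * Real.log x := by ring
      _ ≤ x ^ (1 / 4 : ℝ) * x ^ (1 / 4 : ℝ) := by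
          refine mul_le_mul h3x ?_ hlog0 (Real.rpow_nonneg hx0.le _)
          linarith [h3x, show Real.log x ≤ 4 * Real.log x by linarith]
      _ = x ^ (1 / 2 : ℝ) := by rw [← sq, e]
  · rw [Real.rpow_one] at h4x
    calc c * logPlus x ≤ |c| * logPlus x :=
          mul_le_mul_of_nonneg_right (le_abs_self c) (logPlus_nonneg x)
      _ ≤ |c| * (2 * Real.log x) := mul_le_mul_of_nonneg_left hlpx (abs_nonneg c)
      _ = (2 * |c|) * Real.log x := by ring
      _ ≤ x := h4x

/-- **The elementary real inequality behind the displayed computation** (FMP pp. 17–18, «on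
cancelling and gathering terms»): with `α = ℓ/4 + δ₁`, `β = π/8 − Y/(4x) − tℓ/(8x) + δ₂`,
`t ≤ 0`, `0 ≤ β ≤ π/8`, `R = (Y + 2tα)/4` (= `Re(be^{4w₀})` by (23)),
`t(α² − β²) − R + Yα − xβ ≤ Yℓ/4 + tℓ²/16 − tπ²/64 − πx/8 + (|Y||δ₁| + x|δ₂| + |t||δ₁|/2 + |t||ℓ||δ₁|/2)`
(one-sided: `tδ₁² ≤ 0` and `−tβ² ≤ −tπ²/64`; the linear terms cancel exactly).
[cite: RodgersTaoFMP2020, §2 proof of Lemma 2.1 (FMP pp. 17–18)] -/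
theorem rodgersTao_re_phase_le_core {t α β Y x ℓ δ₁ δ₂ R : ℝ} (ht : t ≤ 0) (hx : 0 ≤ x) (hβ0 : 0 ≤ β)
    (hβ : β ≤ π / 8)
    (hα : α = ℓ / 4 + δ₁) (hβe : β = π / 8 - Y / (4 * x) - t * ℓ / (8 * x) + δ₂)
    (hR : R = (Y + 2 * t * α) / 4)
    (hxβ : x * (π / 8 - Y / (4 * x) - t * ℓ / (8 * x)) = π * x / 8 - Y / 4 - t * ℓ / 8) :
    t * (α ^ 2 - β ^ 2) - R + Y * α - x * β ≤
      Y * ℓ / 4 + t * ℓ ^ 2 / 16 - t * π ^ 2 / 64 - π * x / 8 +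
        (|Y| * |δ₁| + x * |δ₂| + |t| * |δ₁| / 2 + |t| * |ℓ| * |δ₁| / 2) := by
  -- `−tβ² ≤ −tπ²/64`
  have h1 : -(t * β ^ 2) ≤ -(t * π ^ 2 / 64) := by
    have hb2 : β ^ 2 ≤ π ^ 2 / 64 := by
      have : β ^ 2 ≤ (π / 8) ^ 2 := pow_le_pow_left₀ hβ0 hβ 2
      linarith [show (π / 8) ^ 2 = π ^ 2 / 64 by ring]
    nlinarith
  -- `tα² ≤ tℓ²/16 + tℓδ₁/2`
  have h2 : t * α ^ 2 ≤ t * ℓ ^ 2 / 16 + t * ℓ * δ₁ / 2 := by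
    rw [hα]
    have : t * (ℓ / 4 + δ₁) ^ 2 = t * ℓ ^ 2 / 16 + t * ℓ * δ₁ / 2 + t * δ₁ ^ 2 := by ring
    rw [this]
    nlinarith [sq_nonneg δ₁]
  -- the linear terms
  have h3 : -R + Y * α - x * β = -(π * x / 8) + Y * ℓ / 4 + Y * δ₁ - t * δ₁ / 2 - x * δ₂ := by
    rw [hR, hβe, hα]
    have hx' : x * (π / 8 - Y / (4 * x) - t * ℓ / (8 * x) + δ₂) =
        π * x / 8 - Y / 4 - t * ℓ / 8 + x * δ₂ := by rw [mul_add, hxβ]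
    rw [hx']
    ring
  have e : t * (α ^ 2 - β ^ 2) - R + Y * α - x * β =
      t * α ^ 2 + -(t * β ^ 2) + (-R + Y * α - x * β) := by ring
  rw [e, h3]
  have h4 : Y * δ₁ ≤ |Y| * |δ₁| := by rw [← abs_mul]; exact le_abs_self _
  have h5 : -(t * δ₁ / 2) ≤ |t| * |δ₁| / 2 := by
    have := neg_abs_le (t * δ₁); rw [abs_mul] at this; linarith [le_abs_self (t * δ₁), abs_mul t δ₁]
  have h6 : -(x * δ₂) ≤ x * |δ₂| := by nlinarith [neg_abs_le δ₂, abs_nonneg δ₂]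
  have h7 : t * ℓ * δ₁ / 2 ≤ |t| * |ℓ| * |δ₁| / 2 := by
    have : t * ℓ * δ₁ ≤ |t * ℓ * δ₁| := le_abs_self _
    rw [abs_mul, abs_mul] at this
    linarith
  linarith

/-- **Regime (ii) real-part bound, generic form** (FMP pp. 17–18): for `t ∈ [−T₀, 0)`, `b ≥ 1` in
regime (ii) (`b ≤ x e^{100√x/|t|}`, eq. (33)), `ζ = Y + ix` with `0 ≤ Y ≤ c·log₊ x` and `x ≥ X`,
and a solution `w₀ = α + iβ` of (23) in the strip (21) obeying the two Lemma 2.3 (ii) expansions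
with constants `A₁` and `A₂ ≥ 0`, the phase satisfies
`Re(tw₀² − be^{4w₀} + ζw₀) ≤ Yℓ/4 + tℓ²/16 − tπ²/64 − πx/8 + (2A₁ + A₂)`, `ℓ = log(x/4b)`.
The threshold `X` depends on `T₀, c` only.
[cite: RodgersTaoFMP2020, §2 proof of Lemma 2.1 (FMP pp. 17–18)] -/
theorem rodgersTao_re_phase_le_regimeTwo (T₀ c : ℝ) {A₁ A₂ : ℝ} (hA₂ : 0 ≤ A₂) :
    ∃ X : ℝ, 0 < X ∧ ∀ t ∈ Ico (-T₀) 0, ∀ b : ℝ, 1 ≤ b → ∀ ζ : ℂ, X ≤ ζ.im → 0 ≤ ζ.re →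
      ζ.re ≤ c * logPlus ζ.im → b ≤ ζ.im * Real.exp (100 * Real.sqrt ζ.im / |t|) →
      ∀ w₀ ∈ rodgersTaoStrip, rodgersTaoSaddleEq t b ζ w₀ →
        |w₀.re - Real.log (ζ.im / (4 * b)) / 4| ≤ A₁ / ζ.im →
        |w₀.im - (π / 8 - ζ.re / (4 * ζ.im) - t * Real.log (ζ.im / (4 * b)) / (8 * ζ.im))| ≤
            A₂ * logPlus ζ.im ^ 2 / ζ.im ^ (3 / 2 : ℝ) →
        (t * w₀ ^ 2 - (b : ℂ) * Complex.exp (4 * w₀) + ζ * w₀).re ≤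
          ζ.re * Real.log (ζ.im / (4 * b)) / 4 + t * Real.log (ζ.im / (4 * b)) ^ 2 / 16 -
            t * π ^ 2 / 64 - π * ζ.im / 8 + (2 * A₁ + A₂) := by
  obtain ⟨X, hX⟩ := eventually_atTop.1 (rodgersTao_eventually_regimeTwo_thresholds T₀ c)
  refine ⟨max X 1, by positivity, fun t ht b hb ζ hxX hY0 hYc hreg w₀ hw hsad hα hβ ↦ ?_⟩
  obtain ⟨hth1, hth2, hth3, hth4, hx1⟩ := hX ζ.im ((le_max_left _ _).trans hxX)
  set x : ℝ := ζ.im with hxdef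
  set Y : ℝ := ζ.re with hYdef
  set ℓ : ℝ := Real.log (x / (4 * b)) with hℓ
  set α : ℝ := w₀.re with hαdef
  set β : ℝ := w₀.im with hβdef
  have hx0 : 0 < x := by linarith
  obtain ⟨hβ0, hβlt⟩ := (mem_rodgersTaoStrip.1 hw)
  have htle : t ≤ 0 := ht.2.le
  have htabs : |t| ≤ T₀ := by rw [abs_of_neg ht.2]; linarith [ht.1]
  -- the phase in real terms
  rw [rodgersTao_re_phase_of_saddleEq hsad]
  -- decompose `α`, `β`
  set δ₁ : ℝ := α - ℓ / 4 with hδ₁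
  set δ₂ : ℝ := β - (π / 8 - Y / (4 * x) - t * ℓ / (8 * x)) with hδ₂
  have hαe : α = ℓ / 4 + δ₁ := by rw [hδ₁]; ring
  have hβe : β = π / 8 - Y / (4 * x) - t * ℓ / (8 * x) + δ₂ := by rw [hδ₂]; ring
  have hxβ : x * (π / 8 - Y / (4 * x) - t * ℓ / (8 * x)) = π * x / 8 - Y / 4 - t * ℓ / 8 := by
    field_simp
  have hcore := rodgersTao_re_phase_le_core (R := (Y + 2 * t * α) / 4) htle hx0.le hβ0 hβlt.le hαe
    hβe rfl hxβ
  -- the four error terms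
  have hd1 : |δ₁| ≤ A₁ / x := hα
  have hd2 : |δ₂| ≤ A₂ * logPlus x ^ 2 / x ^ (3 / 2 : ℝ) := hβ
  have e1 : |Y| * |δ₁| ≤ A₁ := by
    rw [abs_of_nonneg hY0]
    calc Y * |δ₁| ≤ x * (A₁ / x) := mul_le_mul (hYc.trans hth3) hd1 (abs_nonneg _) hx0.le
      _ = A₁ := by field_simp
  have e2 : x * |δ₂| ≤ A₂ := by
    have hx32 : x ^ (3 / 2 : ℝ) = x * Real.sqrt x := by
      rw [Real.sqrt_eq_rpow, ← Real.rpow_one_add' hx0.le (by norm_num)]; norm_num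
    calc x * |δ₂| ≤ x * (A₂ * logPlus x ^ 2 / x ^ (3 / 2 : ℝ)) :=
          mul_le_mul_of_nonneg_left hd2 hx0.le
      _ = A₂ * (logPlus x ^ 2 / Real.sqrt x) := by
          rw [hx32]; field_simp
      _ ≤ A₂ * 1 := by
          refine mul_le_mul_of_nonneg_left ?_ hA₂
          rw [div_le_one (Real.sqrt_pos.2 hx0)]; exact hth2
      _ = A₂ := mul_one _
  have e3 : |t| * |δ₁| / 2 ≤ A₁ / 2 := by
    have : |t| * |δ₁| ≤ x * (A₁ / x) :=
      mul_le_mul (htabs.trans hth4) hd1 (abs_nonneg _) hx0.le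
    rw [mul_div_cancel₀ _ hx0.ne'] at this
    linarith
  have e4 : |t| * |ℓ| * |δ₁| / 2 ≤ A₁ / 2 := by
    have hl := rodgersTao_abs_mul_abs_log_le ht hb hx1 hreg
    have : |t| * |ℓ| * |δ₁| ≤ x * (A₁ / x) :=
      mul_le_mul (hl.trans hth1) hd1 (abs_nonneg _) hx0.le
    rw [mul_div_cancel₀ _ hx0.ne'] at this
    linarith
  linarith

end Literature.NumberTheory.LFunctions

end
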